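import Summits.HodgeConjecture.CorCM.IrreducibleOddWeightsEvaluation
import HarnessLib

/-!
# The splitting step for orbit spans and evaluation spaces along an equivariant projection

COR-CM (cell `pub-hodgecm2`, binder seat `b16` gen 57, count-neutral claim MULTIPLICITY, file F2 — abstract `G`-set
level, sequel of `CorCM/IrreducibleOddWeightsEvaluation` (notation `𝒪[G, w]` = orbit span of `w ∈ ℚ^X`,
`Ev[G, π, w]` = evaluation space `{T w : T : ℚ^X → V equivariant}` of a representation `(π, V)`; local notation, no
definition); theorems only, no definition, no named fact, no `sorry`).  NEW as stated, hence under `Summits/`.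
HONEST FRAMING: finite-dimensional linear algebra over `ℚ` feeding the rank of families of CM types (`dim` of
Mumford–Tate groups of products of CM abelian varieties); no hypothesis on `G`, `X`; `HC_CM` neither used nor asserted.

THE SPLITTING STEP.  `P ≤ 𝒪[G, w]` a stable subspace, `Q : ℚ^X → ℚ^X` the EQUIVARIANT projection onto `P` (seat
gen 55 `IrrOdd.exists_equivariant_projection`: values in `P`, identity on `P`, commuting with `G` — the orthogonal
projection for the invariant dot product), `p = Q w`, `w″ = w − Q w`:
* `orbitSpan_proj_le`, `orbitSpan_sub_proj_le_ker`, `orbitSpan_le_sup`, **`orbitSpan_proj_eq`** (`𝒪[G, Qw] = P`: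
  a vector of `P` has no `ker Q` component in `𝒪[G, Qw] ⊕ 𝒪[G, w″] ⊆ P ⊕ ker Q`);
* **`finrank_orbitSpan_eq_add`**: `dim 𝒪[G, w] = dim P + dim 𝒪[G, w″]` (`𝒪[G, w] = P ⊕ 𝒪[G, w″]`);
* `evalSpace_proj_le`, `evalSpace_sub_proj_le`, **`finrank_evalSpace_eq_add`**: for EVERY representation `π`,
  `dim Ev[G, π, w] = dim Ev[G, π, Qw] + dim Ev[G, π, w″]` — the sum exhausts by `T w = T(Qw) + T(w″)` and is DIRECT
  because `T₁(Qw) = T₂(w″)` makes `Ψ = T₁ ∘ Q − T₂ ∘ (1 − Q)` an equivariant map killing `w`, hence killing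
  `𝒪[G, w] ⊇ P ∋ Qw`, while `Ψ(Qw) = T₁(Qw)` (CYCLICITY of `𝒪[G, w]`).

Sequel: F3 `CorCM/IrreducibleOddWeightsMultiplicity` (Mai's multiplicity formula by induction on `dim 𝒪[G, w]`).

## References

* [Mai1989] L. Mai, *Lower bounds for the ranks of CM types*, J. Number Theory 32 (1989), §2 Prop. 1 (proof).
* [Serre1977] J.-P. Serre, *Linear Representations of Finite Groups*, GTM 42 (1977), §1.3 Thm. 1, §2.2 Prop. 4.
-/

set_option autoImplicit false

noncomputable section

open scoped BigOperators

universe u u' v w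

namespace Summit.HodgeConjecture.CorCM.IrrOdd

open Literature.NumberTheory.ComplexMultiplication

variable {G : Type w} [Group G] {X : Type v} [MulAction G X]

/-- The orbit span `𝒪[G, w] = span_ℚ {x ↦ w (g • x) : g ∈ G}` (local notation, no definition). -/
local notation3 (prettyPrint := false) "𝒪[" G' ", " w "]" =>
  Submodule.span ℚ (Set.range fun g : G' => fun x => w (g • x))

/-- The evaluation space `Ev[G, π, w] = {T w : T equivariant}` (local notation, no definition). -/
local notation3 (prettyPrint := false) "Ev[" G' ", " π ", " w "]" =>
  Submodule.span ℚ {v | ∃ T : (_ → ℚ) →ₗ[ℚ] _,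
    (∀ (g : G') (f : _ → ℚ), T (fun x => f (g⁻¹ • x)) = π g (T f)) ∧ T w = v}
/-! ### §3 The splitting step along the equivariant projection onto a stable `P ≤ 𝒪[G, w]` -/

section Split

variable {V : Type*} [AddCommGroup V] [Module ℚ V]

/-- `𝒪[G, Q w] ≤ P` for an equivariant `Q` with values in the stable `P`. [cite: Serre1977, §1.3 Thm. 1] -/
theorem orbitSpan_proj_le {P : Submodule ℚ (X → ℚ)}
    (hPst : ∀ (k : G) (a : X → ℚ), a ∈ P → (fun x => a (k • x)) ∈ P)
    (Q : (X → ℚ) →ₗ[ℚ] (X → ℚ)) (hQP : ∀ f, Q f ∈ P) (w : X → ℚ) : 𝒪[G, Q w] ≤ P :=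
  orbitSpan_le hPst (hQP w)

/-- `𝒪[G, w − Q w] ≤ ker Q` for an equivariant idempotent-on-`P` projection `Q`. [cite: Serre1977, §1.3 Thm. 1] -/
theorem orbitSpan_sub_proj_le_ker {P : Submodule ℚ (X → ℚ)}
    (Q : (X → ℚ) →ₗ[ℚ] (X → ℚ)) (hQ : ∀ (g : G) (f : X → ℚ), Q (fun x => f (g⁻¹ • x)) = fun x => Q f (g⁻¹ • x))
    (hQP : ∀ f, Q f ∈ P) (hQid : ∀ a ∈ P, Q a = a) (w : X → ℚ) : 𝒪[G, w - Q w] ≤ LinearMap.ker Q := by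
  refine orbitSpan_le (fun k f hf => ?_) ?_
  · rw [LinearMap.mem_ker] at hf ⊢
    have h := hQ k⁻¹ f
    rw [inv_inv] at h
    rw [h, hf]
    rfl
  · rw [LinearMap.mem_ker, map_sub, hQid _ (hQP w), sub_self]

/-- `𝒪[G, w] ≤ 𝒪[G, Q w] ⊔ 𝒪[G, w − Q w]` (`x ↦ w(gx)` splits accordingly). [cite: Serre1977, §1.3 Thm. 1] -/
theorem orbitSpan_le_sup (Q : (X → ℚ) →ₗ[ℚ] (X → ℚ)) (w : X → ℚ) :
    𝒪[G, w] ≤ 𝒪[G, Q w] ⊔ 𝒪[G, w - Q w] := by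
  refine Submodule.span_le.2 ?_
  rintro _ ⟨g, rfl⟩
  have hsplit : (fun x => w (g • x)) = (fun x => Q w (g • x)) + fun x => (w - Q w) (g • x) := by
    funext x
    simp
  show (fun x => w (g • x)) ∈ _
  rw [hsplit]
  exact Submodule.add_mem_sup (Submodule.subset_span ⟨g, rfl⟩) (Submodule.subset_span ⟨g, rfl⟩)

/-- **`𝒪[G, Q w] = P`** for `P ≤ 𝒪[G, w]` stable and `Q` the equivariant projection onto `P`: every `x ∈ P`
splits in `𝒪[G, Q w] ⊕ 𝒪[G, w − Q w] ⊆ P ⊕ ker Q` and has no `ker Q` component. [cite: Serre1977, §1.3 Thm. 1] -/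
theorem orbitSpan_proj_eq {P : Submodule ℚ (X → ℚ)}
    (hPst : ∀ (k : G) (a : X → ℚ), a ∈ P → (fun x => a (k • x)) ∈ P)
    (Q : (X → ℚ) →ₗ[ℚ] (X → ℚ)) (hQ : ∀ (g : G) (f : X → ℚ), Q (fun x => f (g⁻¹ • x)) = fun x => Q f (g⁻¹ • x))
    (hQP : ∀ f, Q f ∈ P) (hQid : ∀ a ∈ P, Q a = a) {w : X → ℚ} (hPw : P ≤ 𝒪[G, w]) : 𝒪[G, Q w] = P := by
  refine le_antisymm (orbitSpan_proj_le hPst Q hQP w) fun x hx => ?_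
  obtain ⟨a, ha, b, hb, hab⟩ := Submodule.mem_sup.1 (orbitSpan_le_sup Q w (hPw hx))
  have haP : a ∈ P := orbitSpan_proj_le hPst Q hQP w ha
  have hbker : b ∈ LinearMap.ker Q := orbitSpan_sub_proj_le_ker Q hQ hQP hQid w hb
  have hbP : b ∈ P := by
    have : b = x - a := by rw [← hab]; abel
    rw [this]
    exact Submodule.sub_mem _ hx haP
  have hb0 : b = 0 := by
    rw [LinearMap.mem_ker] at hbker
    rw [← hQid b hbP, hbker]
  rw [← hab, hb0, add_zero]
  exact ha

/-- **`dim 𝒪[G, w] = dim P + dim 𝒪[G, w − Q w]`** (`𝒪[G, w] = P ⊕ 𝒪[G, w − Q w]`). [cite: Serre1977, §1.3 Thm. 1] -/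
theorem finrank_orbitSpan_eq_add [Fintype X] {P : Submodule ℚ (X → ℚ)}
    (hPst : ∀ (k : G) (a : X → ℚ), a ∈ P → (fun x => a (k • x)) ∈ P)
    (Q : (X → ℚ) →ₗ[ℚ] (X → ℚ)) (hQ : ∀ (g : G) (f : X → ℚ), Q (fun x => f (g⁻¹ • x)) = fun x => Q f (g⁻¹ • x))
    (hQP : ∀ f, Q f ∈ P) (hQid : ∀ a ∈ P, Q a = a) {w : X → ℚ} (hPw : P ≤ 𝒪[G, w]) :
    Module.finrank ℚ 𝒪[G, w] = Module.finrank ℚ P + Module.finrank ℚ 𝒪[G, w - Q w] := by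
  have hP : 𝒪[G, Q w] = P := orbitSpan_proj_eq hPst Q hQ hQP hQid hPw
  have hsup : 𝒪[G, w] = 𝒪[G, Q w] ⊔ 𝒪[G, w - Q w] := by
    refine le_antisymm (orbitSpan_le_sup Q w) (sup_le ?_ ?_)
    · rw [hP]; exact hPw
    · refine orbitSpan_le (orbitSpan_stable w) (Submodule.sub_mem _ (mem_orbitSpan_self w) (hPw (hQP w)))
  have hinf : 𝒪[G, Q w] ⊓ 𝒪[G, w - Q w] = ⊥ := by
    rw [eq_bot_iff]
    rintro b ⟨hbP, hbker⟩
    have hbP' : b ∈ P := orbitSpan_proj_le hPst Q hQP w hbP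
    have hbker' := orbitSpan_sub_proj_le_ker Q hQ hQP hQid w hbker
    rw [LinearMap.mem_ker] at hbker'
    rw [Submodule.mem_bot, ← hQid b hbP', hbker']
  have h := Submodule.finrank_sup_add_finrank_inf_eq 𝒪[G, Q w] 𝒪[G, w - Q w]
  rw [hinf, finrank_bot, add_zero, ← hsup, hP] at h
  exact h

/-- `Ev[G, π, Q w] ≤ Ev[G, π, w]` (`T(Qw) = (T ∘ Q)(w)`). [cite: Mai1989, §2 Prop. 1 (proof)] -/
theorem evalSpace_proj_le (π : Representation ℚ G V)
    (Q : (X → ℚ) →ₗ[ℚ] (X → ℚ)) (hQ : ∀ (g : G) (f : X → ℚ), Q (fun x => f (g⁻¹ • x)) = fun x => Q f (g⁻¹ • x))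
    (w : X → ℚ) : Ev[G, π, Q w] ≤ Ev[G, π, w] := by
  rw [evalSpace_le_iff]
  intro T hT
  exact Submodule.subset_span ⟨T ∘ₗ Q, equivariant_comp π T hT Q hQ, rfl⟩

/-- `Ev[G, π, w − Q w] ≤ Ev[G, π, w]` (`T(w − Qw) = (T ∘ (1 − Q))(w)`). [cite: Mai1989, §2 Prop. 1 (proof)] -/
theorem evalSpace_sub_proj_le (π : Representation ℚ G V)
    (Q : (X → ℚ) →ₗ[ℚ] (X → ℚ)) (hQ : ∀ (g : G) (f : X → ℚ), Q (fun x => f (g⁻¹ • x)) = fun x => Q f (g⁻¹ • x))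
    (w : X → ℚ) : Ev[G, π, w - Q w] ≤ Ev[G, π, w] := by
  rw [evalSpace_le_iff]
  intro T hT
  have hQ' : ∀ (g : G) (f : X → ℚ), (LinearMap.id - Q : (X → ℚ) →ₗ[ℚ] (X → ℚ)) (fun x => f (g⁻¹ • x)) =
      fun x => (LinearMap.id - Q : (X → ℚ) →ₗ[ℚ] (X → ℚ)) f (g⁻¹ • x) := fun g f => by
    funext x
    simp only [LinearMap.sub_apply, LinearMap.id_apply, Pi.sub_apply, hQ]
  refine Submodule.subset_span ⟨T ∘ₗ (LinearMap.id - Q), equivariant_comp π T hT _ hQ', ?_⟩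
  simp only [LinearMap.comp_apply, LinearMap.sub_apply, LinearMap.id_apply]

/-- **`dim Ev[G, π, w] = dim Ev[G, π, Q w] + dim Ev[G, π, w − Q w]` for EVERY representation `π`**, when
`P ≤ 𝒪[G, w]` is stable and `Q` is the equivariant projection onto `P`: the sum is all of `Ev[π, w]` by
`T w = T(Qw) + T(w − Qw)`, and DIRECT because `T₁(Qw) = T₂(w − Qw)` makes `Ψ = T₁Q − T₂(1 − Q)` an equivariant map
killing `w`, hence killing `𝒪[G, w] ⊇ P ∋ Qw`, and `Ψ(Qw) = T₁(Qw)`. [cite: Mai1989, §2 Prop. 1 (proof)] [cite: Serre1977, §1.3 Thm. 1] -/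
theorem finrank_evalSpace_eq_add [FiniteDimensional ℚ V] (π : Representation ℚ G V)
    {P : Submodule ℚ (X → ℚ)}
    (Q : (X → ℚ) →ₗ[ℚ] (X → ℚ)) (hQ : ∀ (g : G) (f : X → ℚ), Q (fun x => f (g⁻¹ • x)) = fun x => Q f (g⁻¹ • x))
    (hQP : ∀ f, Q f ∈ P) (hQid : ∀ a ∈ P, Q a = a) {w : X → ℚ} (hPw : P ≤ 𝒪[G, w]) :
    Module.finrank ℚ Ev[G, π, w] =
      Module.finrank ℚ Ev[G, π, Q w] + Module.finrank ℚ Ev[G, π, w - Q w] := by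
  have hsup : Ev[G, π, w] = Ev[G, π, Q w] ⊔ Ev[G, π, w - Q w] := by
    refine le_antisymm ?_ (sup_le (evalSpace_proj_le π Q hQ w) (evalSpace_sub_proj_le π Q hQ w))
    rw [evalSpace_le_iff]
    intro T hT
    have hsplit : T w = T (Q w) + T (w - Q w) := by rw [map_sub, add_sub_cancel]
    rw [hsplit]
    exact Submodule.add_mem_sup (Submodule.subset_span ⟨T, hT, rfl⟩) (Submodule.subset_span ⟨T, hT, rfl⟩)
  have hinf : Ev[G, π, Q w] ⊓ Ev[G, π, w - Q w] = ⊥ := by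
    rw [eq_bot_iff]
    rintro v ⟨hv₁, hv₂⟩
    obtain ⟨T₁, hT₁, hv₁⟩ := (mem_evalSpace_iff π (Q w) v).1 hv₁
    obtain ⟨T₂, hT₂, hv₂⟩ := (mem_evalSpace_iff π (w - Q w) v).1 hv₂
    have hQ' : ∀ (g : G) (f : X → ℚ), (LinearMap.id - Q : (X → ℚ) →ₗ[ℚ] (X → ℚ)) (fun x => f (g⁻¹ • x)) =
        fun x => (LinearMap.id - Q : (X → ℚ) →ₗ[ℚ] (X → ℚ)) f (g⁻¹ • x) := fun g f => by
      funext x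
      simp only [LinearMap.sub_apply, LinearMap.id_apply, Pi.sub_apply, hQ]
    let Ψ : (X → ℚ) →ₗ[ℚ] V := T₁ ∘ₗ Q - T₂ ∘ₗ (LinearMap.id - Q)
    have hΨ : ∀ (g : G) (f : X → ℚ), Ψ (fun x => f (g⁻¹ • x)) = π g (Ψ f) := fun g f => by
      simp only [Ψ, LinearMap.sub_apply, equivariant_comp π T₁ hT₁ Q hQ, equivariant_comp π T₂ hT₂ _ hQ', map_sub]
    have hΨw : Ψ w = 0 := by
      simp only [Ψ, LinearMap.sub_apply, LinearMap.comp_apply, LinearMap.id_apply, hv₁, hv₂, sub_self]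
    have hΨQw : Ψ (Q w) = 0 := apply_eq_zero_of_mem_orbitSpan π Ψ hΨ hΨw (hPw (hQP w))
    have hQQ : Q (Q w) = Q w := hQid _ (hQP w)
    simp only [Ψ, LinearMap.sub_apply, LinearMap.comp_apply, LinearMap.id_apply, hQQ, sub_self, map_zero,
      sub_zero, hv₁] at hΨQw
    rw [Submodule.mem_bot, hΨQw]
  have h := Submodule.finrank_sup_add_finrank_inf_eq Ev[G, π, Q w] Ev[G, π, w - Q w]
  rw [hinf, finrank_bot, add_zero, ← hsup] at h
  exact h

end Split

end Summit.HodgeConjecture.CorCM.IrrOdd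

end
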